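import Summits.CriticalPhenomena.CardyFormulaZ2.Theorems.CardySusyWardDiscretisationFamilyExistsSidesB
import Summits.CriticalPhenomena.CardyFormulaZ2.Theorems.CardySusyWardDiscretisationFamilyExistsLeg
import Summits.CriticalPhenomena.CardyFormulaZ2.Theorems.CardySusyWardDiscretisationFamilyExistsLocalConn
import Mathlib.Topology.Connected.LocallyPathConnected
import HarnessLib

/-!
# The labelling at every small mesh, for a fixed tolerance — helper for `DiscretisationFamilyExists` (stmt-CriticalPhenomena-9644)

`eventually_labelling`: for a Dobrushin domain `D` and `η > 0`, for all small `δ > 0` there are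
labels `SA, SB` of the discrete boundary `∂Ω_δ` with the ten properties consumed by
`zdDiscretisationFamily_of_labelling` at this mesh with tolerance `η`, and the midpoints of the
two-coloured edges within `η` of `{a, b}`.  Assembly of: the local control of the boundary loop
at the marks (`boundary_localization`), the legs (`eventually_legData`), a deep connection
between them, the cross-cut (`exists_crosscut`), boundary parameters of its ends, and the
labelling by its two sides (`labelling_of_crosscut`).
-/

noncomputable section

open Set Metric Filter
open Literature.Probability.LatticeModels Literature.Probability.Percolation
  Literature.Probability.LatticeModels.DiscreteDobrushin Literature.Probability.RandomPlanarGeometry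
  Literature.Topology.PlaneTopology

namespace Summit.CriticalPhenomena.CardyFormulaZ2.Theorems.DiscretisationFamilyExists

/-- A disc inside an open set keeps its centre at least its radius away from the frontier.
[folklore] -/
theorem le_infDist_frontier_of_ball_subset {Ω : Set ℂ} (hΩ : IsOpen Ω) {p : ℂ} {ρ : ℝ}
    (hball : ball p ρ ⊆ Ω) (hne : (frontier Ω).Nonempty) : ρ ≤ infDist p (frontier Ω) := by
  rw [le_infDist hne]
  intro f hf
  by_contra h; push Not at h
  have hfΩ : f ∈ Ω := hball (mem_ball'.2 h)
  rw [hΩ.frontier_eq] at hf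
  exact hf.2 hfΩ

set_option maxHeartbeats 3200000 in
/-- **The labelling at every small mesh.** See the module docstring. [folklore] -/
theorem eventually_labelling (D : DobrushinDomain) {η : ℝ} (hη : 0 < η) :
    ∀ᶠ δ in nhdsWithin (0 : ℝ) (Set.Ioi 0), ∃ SA SB : Set (Site 2),
      (SA ∪ SB = (⟨D.carrier, δ, ∅, ∅⟩ : DiscreteDobrushin).zdBoundary ∧
      Disjoint SA SB ∧ SA.Nonempty ∧ SB.Nonempty ∧
      (∀ y ∈ SA, ¬ Metric.closedBall (meshPoint δ y)
          (Metric.infDist (meshPoint δ y) (frontier D.carrier)) ⊆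
        ⋃ x ∈ SB, Metric.closedBall (meshPoint δ x)
          (Metric.infDist (meshPoint δ x) (frontier D.carrier))) ∧
      (∀ x ∈ SB, ¬ Metric.closedBall (meshPoint δ x)
          (Metric.infDist (meshPoint δ x) (frontier D.carrier)) ⊆
        ⋃ y ∈ SA, Metric.closedBall (meshPoint δ y)
          (Metric.infDist (meshPoint δ y) (frontier D.carrier))) ∧
      (∀ y ∈ SA, Metric.infDist (meshPoint δ y) (D.arc 0) ≤ η) ∧
      (∀ x ∈ SB, Metric.infDist (meshPoint δ x) (D.arc 1) ≤ η) ∧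
      {e | e ∈ (discreteDomainGraph D.carrier δ).edgeSet ∧ (∃ x ∈ e, x ∈ SA) ∧
        ∃ y ∈ e, y ∈ SB}.ncard = 2 ∧
      ∀ e ∈ (discreteDomainGraph D.carrier δ).edgeSet, (∃ x ∈ e, x ∈ SA) → (∃ y ∈ e, y ∈ SB) →
        ∃! f, (⟨D.carrier, δ, ∅, ∅⟩ : DiscreteDobrushin).IsInnerFace f ∧ ∀ x ∈ e, IsCorner x f) ∧
      Metric.hausdorffEDist (medialPoint δ ''
        {e | e ∈ (discreteDomainGraph D.carrier δ).edgeSet ∧ (∃ x ∈ e, x ∈ SA) ∧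
          ∃ y ∈ e, y ∈ SB}) {D.pt 0, D.pt 1} ≤ ENNReal.ofReal η := by
  obtain ⟨hΩ, hext, hunb, hJE⟩ := regular_of_eq_carrier (D := ⟨D.carrier, 1, ∅, ∅⟩) D.toJordanDomain rfl
  dsimp only at hΩ hext hunb hJE
  set a := D.pt 0 with ha
  set b := D.pt 1 with hb
  have hab : a ≠ b := fun h => by
    have := D.pt_injective h; exact absurd this (by decide)
  have hdab : 0 < dist a b := dist_pos.2 hab
  have hafr : a ∈ frontier D.carrier := D.pt_mem_frontier 0
  have hbfr : b ∈ frontier D.carrier := D.pt_mem_frontier 1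
  -- marks
  have hm01 : D.mark 0 < D.mark 1 := D.strictMono_mark (by decide)
  have hm0 := D.mark_mem 0
  have hm1 := D.mark_mem 1
  set κs : ℝ := min ((D.mark 1 - D.mark 0) / 2) ((D.mark 0 + 1 - D.mark 1) / 2) with hκs
  have hκs0 : 0 < κs := lt_min (by linarith) (by linarith [hm1.2, hm0.1])
  -- tolerances
  set η' : ℝ := min (η / 3) (dist a b / 8) with hη'
  have hη'0 : 0 < η' := lt_min (by linarith) (by linarith)
  obtain ⟨κa, η₁a, hκa, hκas, hη₁a, hη₁a', hloca, hloca'⟩ :=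
    boundary_localization D.toJordanDomain (D.mark 0) hη'0 hκs0
  obtain ⟨κb, η₁b, hκb, hκbs, hη₁b, hη₁b', hlocb, hlocb'⟩ :=
    boundary_localization D.toJordanDomain (D.mark 1) hη'0 hκs0
  set η₁ := min η₁a η₁b with hη₁
  have hη₁0 : 0 < η₁ := lt_min hη₁a hη₁b
  have hη₁η' : η₁ ≤ η' := (min_le_left _ _).trans hη₁a'
  -- legs
  obtain ⟨pA, ρA, hρA, hbA, hpA, hLA⟩ := eventually_legData D.toJordanDomain hafr hη₁0
  obtain ⟨pB, ρB, hρB, hbB, hpB, hLB⟩ := eventually_legData D.toJordanDomain hbfr hη₁0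
  have hpAΩ : pA ∈ D.carrier := hbA (mem_ball_self hρA)
  have hpBΩ : pB ∈ D.carrier := hbB (mem_ball_self hρB)
  -- a deep connection between the deep points
  have hpath : JoinedIn D.carrier pA pB :=
    ((D.isOpen.isConnected_iff_isPathConnected).1 D.isConnected).joinedIn pA hpAΩ pB hpBΩ
  obtain ⟨γ, hγ⟩ := hpath
  set K := range γ with hK
  have hKc : IsCompact K := isCompact_range γ.continuous
  have hKΩ : K ⊆ D.carrier := by rintro _ ⟨u, rfl⟩; exact hγ u
  have hfrne : (frontier D.carrier).Nonempty := ⟨a, hafr⟩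
  obtain ⟨zm, hzm, hzmin⟩ := hKc.exists_isMinOn (range_nonempty γ) (continuous_infDist_pt (frontier D.carrier)).continuousOn
  set τ := infDist zm (frontier D.carrier) with hτ
  have hτ0 : 0 < τ := by
    refine (isClosed_frontier.notMem_iff_infDist_pos hfrne).1 fun h => ?_
    rw [hΩ.frontier_eq] at h; exact h.2 (hKΩ hzm)
  have hKdeep : ∀ z ∈ K, τ ≤ infDist z (frontier D.carrier) := fun z hz => hzmin hz
  -- the scale
  set δ₀ : ℝ := min (min (τ / 21) (min (ρA / 26) (ρB / 26))) (min (η / 6) (dist a b / 16)) with hδ₀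
  have hδ₀0 : 0 < δ₀ := by positivity
  filter_upwards [hLA, hLB, Ioo_mem_nhdsGT hδ₀0] with δ hLa hLb hδ
  obtain ⟨p₁a, hp₁a, ⟨La⟩⟩ := hLa
  obtain ⟨p₁b, hp₁b, ⟨Lb⟩⟩ := hLb
  obtain ⟨hδ0, hδ1⟩ := hδ
  have h1 : δ ≤ τ / 21 := hδ1.le.trans ((min_le_left _ _).trans (min_le_left _ _))
  have h2 : δ ≤ ρA / 26 := hδ1.le.trans ((min_le_left _ _).trans ((min_le_right _ _).trans (min_le_left _ _)))
  have h3 : δ ≤ ρB / 26 := hδ1.le.trans ((min_le_left _ _).trans ((min_le_right _ _).trans (min_le_right _ _)))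
  have h4 : δ ≤ η / 6 := hδ1.le.trans ((min_le_right _ _).trans (min_le_left _ _))
  have h5 : δ ≤ dist a b / 16 := hδ1.le.trans ((min_le_right _ _).trans (min_le_right _ _))
  -- the deep open set
  set W : Set ℂ := {z | z ∈ D.carrier ∧ 20 * δ < infDist z (frontier D.carrier)} with hW
  have hWo : IsOpen W := D.isOpen.inter (isOpen_lt continuous_const (continuous_infDist_pt _))
  set C := connectedComponentIn W pA with hC
  have hCo : IsOpen C := hWo.connectedComponentIn
  have hCc : IsPreconnected C := isPreconnected_connectedComponentIn
  have hCdeep : ∀ z ∈ C, z ∈ D.carrier ∧ 20 * δ < infDist z (frontier D.carrier) := fun z hz =>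
    (connectedComponentIn_subset W pA : C ⊆ W) hz
  have hsegW : ∀ (p z : ℂ) (ρ : ℝ), ball p ρ ⊆ D.carrier → 26 * δ ≤ ρ → dist z p ≤ 5 * δ → segment ℝ p z ⊆ W := by
    intro p z ρ hball hρ hz w hw
    have hwp : dist w p ≤ 5 * δ := by
      have h := (convex_closedBall p (dist p z)).segment_subset (mem_closedBall_self dist_nonneg)
        (mem_closedBall.2 (by rw [dist_comm])) hw
      exact (mem_closedBall.1 h).trans (by rw [dist_comm]; exact hz)
    have hinf := le_infDist_frontier_of_ball_subset hΩ hball hfrne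
    have := infDist_le_infDist_add_dist (s := frontier D.carrier) (x := p) (y := w)
    rw [dist_comm] at this
    exact ⟨hball (mem_ball.2 (by linarith)), by linarith⟩
  have hztA : La.ztop ∈ C := by
    have hd : dist La.ztop pA ≤ 5 * δ := by linarith [dist_triangle La.ztop p₁a pA, La.dist_ztop]
    exact (convex_segment pA La.ztop).isPreconnected.subset_connectedComponentIn (left_mem_segment _ _ _)
      (hsegW pA La.ztop ρA hbA (by linarith) hd) (right_mem_segment _ _ _)
  have hpBC : pB ∈ C := by
    have hKW : K ⊆ W := fun z hz => ⟨hKΩ hz, by linarith [hKdeep z hz]⟩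
    have : K ⊆ C := (isConnected_range γ.continuous).isPreconnected.subset_connectedComponentIn ⟨0, γ.source⟩ hKW
    exact this ⟨1, γ.target⟩
  have hztB : Lb.ztop ∈ C := by
    have hd : dist Lb.ztop pB ≤ 5 * δ := by linarith [dist_triangle Lb.ztop p₁b pB, Lb.dist_ztop]
    rw [hC, connectedComponentIn_eq hpBC]
    exact (convex_segment pB Lb.ztop).isPreconnected.subset_connectedComponentIn (left_mem_segment _ _ _)
      (hsegW pB Lb.ztop ρB hbB (by linarith) hd) (right_mem_segment _ _ _)
  -- the cross-cut
  have hsep : 2 * η₁ + 12 * δ ≤ dist a b := by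
    have : η' ≤ dist a b / 8 := min_le_right _ _
    linarith
  obtain ⟨χ, hcross, hBχ, hedge, hz₀a, hz₀b, -, -, hsecA, hsecB, haUa, haVa, haUb, haVb, hbVa, hbUa, hbVb, hbUb, hnear⟩ :=
    exists_crosscut hδ0 La Lb hsep hCo hCc hCdeep hztA hztB
  -- boundary parameters of the landing points
  have hca : dist La.c a < η₁ := La.subset_ball (Or.inl La.arcP.right_mem)
  have hcb : dist Lb.c b < η₁ := Lb.subset_ball (Or.inl Lb.arcP.right_mem)
  obtain ⟨u₀, hu₀⟩ : La.c ∈ range D.boundary := by rw [D.range_boundary]; exact La.c_mem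
  obtain ⟨v₀, hv₀⟩ : Lb.c ∈ range D.boundary := by rw [D.range_boundary]; exact Lb.c_mem
  obtain ⟨s, hsI, hsu⟩ := D.periodic_boundary.exists_mem_Ico one_pos u₀ (D.mark 0 - 1 / 2)
  obtain ⟨t, htI, htv⟩ := D.periodic_boundary.exists_mem_Ico one_pos v₀ (D.mark 1 - 1 / 2)
  have hs : D.boundary s = La.c := by rw [← hsu, hu₀]
  have ht : D.boundary t = Lb.c := by rw [← htv, hv₀]
  have hsm : |s - D.mark 0| < κa := by
    refine hloca' s ⟨hsI.1, by linarith [hsI.2]⟩ ?_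
    rw [hs]; exact hca.trans_le ((min_le_left _ _).trans le_rfl) |> fun h => by
      show dist La.c (D.boundary (D.mark 0)) < η₁a
      exact lt_of_lt_of_le hca (min_le_left _ _)
  have htm : |t - D.mark 1| < κb := by
    refine hlocb' t ⟨htI.1, by linarith [htI.2]⟩ ?_
    rw [ht]
    show dist Lb.c (D.boundary (D.mark 1)) < η₁b
    exact lt_of_lt_of_le hcb (min_le_right _ _)
  have hκa2 : κa ≤ (D.mark 1 - D.mark 0) / 2 := hκas.trans (min_le_left _ _)
  have hκb2 : κb ≤ (D.mark 1 - D.mark 0) / 2 := hκbs.trans (min_le_left _ _)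
  have hκa3 : κa ≤ (D.mark 0 + 1 - D.mark 1) / 2 := hκas.trans (min_le_right _ _)
  have hκb3 : κb ≤ (D.mark 0 + 1 - D.mark 1) / 2 := hκbs.trans (min_le_right _ _)
  have hst : s < t := by rw [abs_lt] at hsm htm; linarith
  have hts : t < s + 1 := by rw [abs_lt] at hsm htm; linarith
  -- the labelling
  obtain ⟨SA, SB, ⟨c1, c2, c3, c4, c5, c6, c7, c8, c9, c10⟩, hpts⟩ :=
    labelling_of_crosscut D hδ0 hη'0 La Lb hsep hcross hBχ hedge hz₀a hz₀b hsecA hsecB haUa haVa haUb haVb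
      hbVa hbUa hbVb hbUb hnear hs ht hst hts hsm htm
      (fun u hu => hloca u hu) (fun u hu => hlocb u hu)
  have hε : η' + η₁ + 2 * δ ≤ η := by
    have : η' ≤ η / 3 := min_le_left _ _
    linarith
  refine ⟨SA, SB, ⟨c1, c2, c3, c4, c5, c6, fun y hy => (c7 y hy).trans hε, fun x hx => (c8 x hx).trans hε, c9, c10⟩,
    hpts.trans (ENNReal.ofReal_le_ofReal (by linarith [min_le_left (η / 3) (dist a b / 8)]))⟩

end Summit.CriticalPhenomena.CardyFormulaZ2.Theorems.DiscretisationFamilyExists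

end
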